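import Summits.ResolutionOfSingularities.ResolutionOfSingularities.Theorems.FrobeniusLadderFInjectiveMacaulayficationPointFloorLegalOfIsolated
import Summits.ResolutionOfSingularities.ResolutionOfSingularities.Theorems.FrobeniusLadderFInjectiveMacaulayficationStalkChartIso
import Summits.ResolutionOfSingularities.ResolutionOfSingularities.Theorems.FrobeniusLadderFInjectiveMacaulayficationQuotientOriginMaximal
import Summits.ResolutionOfSingularities.ResolutionOfSingularities.Theorems.FrobeniusLadderFInjectiveMacaulayficationFiLocusOpenOfAffine
import HarnessLib

/-!
# GENERIC POINT-FLOOR LEGALITY FOR ISOLATED COMPLETE-INTERSECTION (or any) SINGULARITIES, from CM charts COVERING the blow-up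
# (the CI twin of ✓ `PointFloorLegalOfIsolated`: the per-chart CM input is asked only for a set of charts `D₊(x̄ⱼt)` whose union is `Bl_𝔪 X` — e.g. because the other
# `x̄ᵢt` are nilpotent modulo them in the Rees algebra)
# (crux `FInjectiveMacaulayfication` stmt-ResolutionOfSingularities-15315, chain w45a; res-L1-w45a-plan-1 RULING R23.11 (2) «FLOOR columns = CI twins of `PointFloorLegalOfIsolated` /
# `PointFloorNotFullOfFedder`»; seat res-L1-w45a-stub-2 g13)

[OURS · L1 W4.5a] Support file (`--supports stmt-ResolutionOfSingularities-15315 --as helper`); unconditional; def-free; characteristic-free; replaces the role of NO printed item;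
NOT a statement of the manuscript; AI-written (AI review is weaker than expert review). Nothing of the crux is proved.

* §1 `exists_mem_basicOpen_of_mem_radical` — SUB-COVERS OF `Proj`: if `f ∈ √(T)` then `D₊(f) ⊆ ⋃_{g ∈ T} D₊(g)` (a homogeneous prime avoiding `f` avoids some `g ∈ T`);
  ★ `cmCl_stalk_affineBlowup_of_subcover` — CM at EVERY stalk of `Bl_I Spec R`, `I = (x₁, …, x_r)`, from CM at every prime of the Rees charts `D₊(xⱼt)` of a family of «good»
  generators such that every non-zero `xᵢt` is in the radical of the good `xⱼt` (✓ `StalkChartIso` placed chart by chart).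
* §2 `support_specializes`, `origin_ne_bot` (for `R = k[X]/I`, `I ⊆ (X)` proper), ★★★ `pointFloor_input_legal` — for `X = Spec k[X₀..X_{n−1}]/I` (`I` PRIME, `I ⊆ (X)`), `v` the
  origin NOT regular with every proper generization regular, and CM good charts as in §1: for EVERY blowing up `g : S′ → Spec 𝒪_{X,v}` along `𝔪̃|`: (i) the centre is `≠ ⊥`;
  (ii) its support lies in `(Reg Spec 𝒪_{X,v})ᶜ`; (iii) `S′` is regular off the closed fibre; (iv) `S′` is CM at every stalk (✓ `TauFloorInputLegal.offFibre_regular_and_cmCl`).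
[folklore assembly; cite: GortzWedhorn2020, Prop. 13.91 (2), (13.19); StacksProject, Tag 02OS and Tag 0804; Temkin2008, §2.1; Matsumura1987, Thm. 17.4]
-/

-- single-problem summit: the doubled namespace component is forced
set_option linter.dupNamespace false

noncomputable section

namespace Summit.ResolutionOfSingularities.ResolutionOfSingularities.Theorems.FInjectiveMacaulayfication.PointFloorLegalCI

open CategoryTheory CategoryTheory.Limits AlgebraicGeometry TopologicalSpace IsLocalRing MvPolynomial
open Literature.AlgebraicGeometry.Resolution
open Summit.ResolutionOfSingularities.ResolutionOfSingularities.Theorems.FInjectiveMacaulayfication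
open SliceableCentre GermOfGlobalBlowup

/-! ## §1 Sub-covers of the blow-up and CM stalks -/

/-- **SUB-COVERS OF `Proj`**: if `f` lies in the radical of the ideal generated by `T`, every point of `D₊(f)` lies in `D₊(g)` for some `g ∈ T` (the homogeneous prime of the point
is a prime ideal avoiding `f`, so it cannot contain `T`). [folklore; cite: StacksProject, Tag 0804] -/
theorem exists_mem_basicOpen_of_mem_radical {R : Type} [CommRing R] (I : Ideal R) (f : reesAlgebra I) (T : Set (reesAlgebra I))
    (hf : f ∈ (Ideal.span T).radical) (y : ↥(affineBlowup I)) (hy : y ∈ Proj.basicOpen (reesGrading I) f) :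
    ∃ g ∈ T, y ∈ Proj.basicOpen (reesGrading I) g := by
  by_contra h
  push Not at h
  have hle : Ideal.span T ≤ y.asHomogeneousIdeal.toIdeal := by
    rw [Ideal.span_le]
    intro g hg
    have h1 := h g hg
    rw [Proj.mem_basicOpen] at h1
    exact not_not.mp h1
  have hrad : (Ideal.span T).radical ≤ y.asHomogeneousIdeal.toIdeal := (y.isPrime.radical_le_iff).mpr hle
  rw [Proj.mem_basicOpen] at hy
  exact hy (hrad hf)

/-- ★ **CM at every stalk of `Bl_I(Spec R)`, `I = (x₁,…,x_r)`, from CM at every prime of the Rees charts of the GOOD generators**, provided every non-zero `xᵢt` lies in the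
radical of `(xⱼt : j good)` in the Rees algebra (so the good charts cover the blow-up). [folklore; cite: StacksProject, Tag 0804] -/
theorem cmCl_stalk_affineBlowup_of_subcover {R : Type} [CommRing R] {r : ℕ} (x : Fin r → R) (good : Fin r → Prop)
    (hrad : ∀ i : Fin r, x i ≠ 0 → reesT (x i) (Ideal.subset_span (Set.mem_range_self i)) ∈
      (Ideal.span {z : reesAlgebra (Ideal.span (Set.range x)) | ∃ j : Fin r, good j ∧ z = reesT (x j) (Ideal.subset_span (Set.mem_range_self j))}).radical)
    (hCM : ∀ j : Fin r, good j → ∀ (q : Ideal (HomogeneousLocalization.Away (reesGrading (Ideal.span (Set.range x)))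
      (reesT (x j) (Ideal.subset_span (Set.mem_range_self j))))) [q.IsPrime], CMCl (Localization.AtPrime q))
    (y : ↥(affineBlowup (Ideal.span (Set.range x)))) : CMCl ((affineBlowup (Ideal.span (Set.range x))).presheaf.stalk y) := by
  obtain ⟨i, hxi, hi⟩ := StalkChartIso.exists_mem_basicOpen_reesT x y
  obtain ⟨_, ⟨j, hj, rfl⟩, hyj⟩ := exists_mem_basicOpen_of_mem_radical _ _ _ (hrad i hxi) y hi
  rw [← Proj.opensRange_awayι (reesGrading (Ideal.span (Set.range x)))
    (reesT (x j) (Ideal.subset_span (Set.mem_range_self j)))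
    (reesT_mem (x j) (Ideal.subset_span (Set.mem_range_self j))) Nat.one_pos] at hyj
  obtain ⟨q, rfl⟩ := Scheme.Hom.mem_opensRange.mp hyj
  have e : ((affineBlowup (Ideal.span (Set.range x))).presheaf.stalk
      ((Proj.awayι (reesGrading (Ideal.span (Set.range x))) (reesT (x j) (Ideal.subset_span (Set.mem_range_self j)))
        (reesT_mem (x j) (Ideal.subset_span (Set.mem_range_self j))) Nat.one_pos).base q)) ≃+* Localization.AtPrime q.asIdeal :=
    ((asIso ((Proj.awayι (reesGrading (Ideal.span (Set.range x)))
      (reesT (x j) (Ideal.subset_span (Set.mem_range_self j)))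
      (reesT_mem (x j) (Ideal.subset_span (Set.mem_range_self j))) Nat.one_pos).stalkMap q)).commRingCatIsoToRingEquiv).trans
      (Spec.stalkIso (.of _) q).commRingCatIsoToRingEquiv
  exact FiLocusOpenOfAffine.cmClause_of_ringEquiv e.symm (hCM j hj q.asIdeal)

/-! ## §2 ★★★ Point-floor legality for `X = Spec k[X]/I` -/

variable (k : Type) [Field k] {n : ℕ}

/-- The support of `𝔪̃` does not generize past the origin. [plumbing] -/
theorem support_specializes (I : Ideal (MvPolynomial (Fin n) k)) (v : Spec (.of (MvPolynomial (Fin n) k ⧸ I)))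
    (hv : v.asIdeal = Ideal.span (Set.range (fun j : Fin n => Ideal.Quotient.mk I (X j)))) :
    ∀ y ∈ (((affineBlowup.idealSheaf (Ideal.span (Set.range (fun j : Fin n => Ideal.Quotient.mk I (X j)))))).support : Set (Spec (.of (MvPolynomial (Fin n) k ⧸ I)))),
      y ⤳ v → y = v := by
  intro y hy hyv
  rw [affineBlowup.support_idealSheaf] at hy
  have h1 : v.asIdeal ≤ y.asIdeal := by rw [hv]; exact fun a ha => hy ha
  have h2 : y.asIdeal ≤ v.asIdeal := (PrimeSpectrum.le_iff_specializes y v).mpr hyv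
  exact PrimeSpectrum.ext (le_antisymm h2 h1)

/-- The origin ideal `𝔪 = (x̄₀, …, x̄_{n−1})` of `k[X]/I` is nonzero when some `X_j ∉ I`. [plumbing] -/
theorem origin_ne_bot (I : Ideal (MvPolynomial (Fin n) k)) (j : Fin n) (hj : (X j : MvPolynomial (Fin n) k) ∉ I) :
    Ideal.span (Set.range (fun j : Fin n => Ideal.Quotient.mk I (X j))) ≠ ⊥ := by
  intro h0
  have hmem : Ideal.Quotient.mk I (X j) ∈ Ideal.span (Set.range (fun j : Fin n => Ideal.Quotient.mk I (X j))) := Ideal.subset_span ⟨j, rfl⟩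
  rw [h0, Ideal.mem_bot, Ideal.Quotient.eq_zero_iff_mem] at hmem
  exact hj hmem

/-- ★★★ **GENERIC POINT-FLOOR LEGALITY, SUB-COVER FORM.** `I ⊆ k[X₀..X_{n−1}]` PRIME, `R = k[X]/I`, `x̄ⱼ` the classes of the variables with some `Xⱼ ∉ I`; `v` the origin of
`X = Spec R`, NOT regular, every proper generization of `v` regular; a family of GOOD chart indices such that every non-zero `x̄ᵢt` lies in `√(x̄ⱼt : j good)` in the Rees
algebra `R[𝔪t]` and every Rees chart `(R[𝔪t])_{(x̄ⱼt)}` of a good `j` is CM at every prime. Then for EVERY blowing up `g : S′ → Spec 𝒪_{X,v}` along `𝔪̃|_{Spec 𝒪_{X,v}}`: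
(i) the centre is `≠ ⊥`; (ii) its support lies in `(Reg Spec 𝒪_{X,v})ᶜ`; (iii) `S′` is regular off the closed fibre; (iv) `S′` is CM at every stalk.
[folklore assembly; cite: GortzWedhorn2020, Prop. 13.91 (2)] [cite: StacksProject, Tag 02OS; Tag 0804] [cite: Temkin2008, §2.1] -/
theorem pointFloor_input_legal (I : Ideal (MvPolynomial (Fin n) k)) [hI : I.IsPrime] (j₀ : Fin n) (hj₀ : (X j₀ : MvPolynomial (Fin n) k) ∉ I)
    (good : Fin n → Prop)
    (hrad : ∀ i : Fin n, Ideal.Quotient.mk I (X i) ≠ 0 →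
      reesT ((fun j : Fin n => Ideal.Quotient.mk I (X j)) i) (Ideal.subset_span (Set.mem_range_self i)) ∈
      (Ideal.span {z : reesAlgebra (Ideal.span (Set.range (fun j : Fin n => Ideal.Quotient.mk I (X j)))) |
        ∃ j : Fin n, good j ∧ z = reesT ((fun j : Fin n => Ideal.Quotient.mk I (X j)) j) (Ideal.subset_span (Set.mem_range_self j))}).radical)
    (hCM : ∀ j : Fin n, good j → ∀ (q : Ideal (HomogeneousLocalization.Away (reesGrading (Ideal.span (Set.range (fun j : Fin n => Ideal.Quotient.mk I (X j)))))
      (reesT ((fun j : Fin n => Ideal.Quotient.mk I (X j)) j) (Ideal.subset_span (Set.mem_range_self j))))) [q.IsPrime], CMCl (Localization.AtPrime q))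
    (v : Spec (.of (MvPolynomial (Fin n) k ⧸ I))) (hv : v.asIdeal = Ideal.span (Set.range (fun j : Fin n => Ideal.Quotient.mk I (X j))))
    (hsing : v ∉ Scheme.regularLocus (Spec (.of (MvPolynomial (Fin n) k ⧸ I))))
    (hreg : ∀ y : Spec (.of (MvPolynomial (Fin n) k ⧸ I)), y ⤳ v → y ≠ v → y ∈ Scheme.regularLocus (Spec (.of (MvPolynomial (Fin n) k ⧸ I))))
    (S' : Scheme.{0}) (g' : S' ⟶ Spec ((Spec (.of (MvPolynomial (Fin n) k ⧸ I))).presheaf.stalk v))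
    (hg' : IsBlowup g' ((affineBlowup.idealSheaf (Ideal.span (Set.range (fun j : Fin n => Ideal.Quotient.mk I (X j))))).comap ((Spec (.of (MvPolynomial (Fin n) k ⧸ I))).fromSpecStalk v))) :
    ((affineBlowup.idealSheaf (Ideal.span (Set.range (fun j : Fin n => Ideal.Quotient.mk I (X j))))).comap ((Spec (.of (MvPolynomial (Fin n) k ⧸ I))).fromSpecStalk v)) ≠ ⊥ ∧
    ((((affineBlowup.idealSheaf (Ideal.span (Set.range (fun j : Fin n => Ideal.Quotient.mk I (X j))))).comap ((Spec (.of (MvPolynomial (Fin n) k ⧸ I))).fromSpecStalk v)).support :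
        Set (Spec ((Spec (.of (MvPolynomial (Fin n) k ⧸ I))).presheaf.stalk v))) ⊆
      (Scheme.regularLocus (Spec ((Spec (.of (MvPolynomial (Fin n) k ⧸ I))).presheaf.stalk v)))ᶜ) ∧
    (∀ s : S', g'.base s ≠ closedPoint ((Spec (.of (MvPolynomial (Fin n) k ⧸ I))).presheaf.stalk v) → s ∈ Scheme.regularLocus S') ∧
    (∀ s : S', CMCl (S'.presheaf.stalk s)) := by
  classical
  haveI : IsDomain (MvPolynomial (Fin n) k ⧸ I) := Ideal.Quotient.isDomain _
  haveI : IsIntegral (Spec (.of (MvPolynomial (Fin n) k ⧸ I))) := inferInstance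
  have hsupp := support_specializes k I v hv
  have h34 := TauFloorInputLegal.offFibre_regular_and_cmCl v (affineBlowup.isBlowup _) hsupp hreg
    (cmCl_stalk_affineBlowup_of_subcover _ good hrad hCM) hg'
  exact ⟨comap_fromSpecStalk_ne_bot (affineBlowup.idealSheaf_ne_bot (origin_ne_bot k I j₀ hj₀)) v,
    TauFloorInputLegal.support_comap_subset_compl_regularLocus v _ hsupp hsing, h34.1, h34.2⟩

end Summit.ResolutionOfSingularities.ResolutionOfSingularities.Theorems.FInjectiveMacaulayfication.PointFloorLegalCI

end
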